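import Summits.BirchSwinnertonDyer.BirchSwinnertonDyer.Theorems.AdditiveBranchIMCTwistFieldCharIdeal
import Summits.BirchSwinnertonDyer.BirchSwinnertonDyer.Theorems.AdditiveBranchIMCTwistFieldDefs
import Summits.BirchSwinnertonDyer.Rank1Residual.AdditivePotMult.GeneratorNormalisation
import Summits.BirchSwinnertonDyer.Rank1Residual.Additive.ChiEigenPrimeToPDescentGenerator
import Literature.NumberTheory.EllipticCurves.IwasawaSelmerDualProofs
import Literature.NumberTheory.EllipticCurves.SelmerInftyTorsionFiniteProofs
import HarnessLib

/-!
# Crux `GordTwoRankZeroOffCaseOne` (route `AdditiveBranchIMC`, item 19357), lane k1-c2x: the REDUCTION —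
# the K-level containment over the twist field `K = ℚ(√p*)` versus the `ω^{(p−1)/2}`-branch containment
# over `ℚ_∞`, both ways (sequel of `…TwistFieldDecomposition`, `…TwistFieldCharIdeal`, `…TwistFieldDefs`)

Cell `bsd-addord`, seat `bsd-addord-k1-c2x` (second prover lane on item 19357; director-bsd 2026-08-27:
«uniform IMC-branch divisibility via Skinner–Urban over the quadratic twist field with explicit control
at the additive prime»). HONEST FRAMING: theorems only; every published input is a DISPLAYED hypothesis
(Kato 2004 Thm. 17.4 in integral form for the good ordinary twist `V` over `ℚ_∞`, Rohrlich's
`L_p(f, α, T) ≠ 0`), the K-level containment `TwistFieldLowerDivisibility[Even|Odd]At V p` is the typed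
CONJECTURE of `…TwistFieldDefs` (nothing asserted about it), nothing is booked; BSD is not proved by any
of this. Content, for `E = W = C • V^{(p*)}`, `V` good ordinary at the odd prime `p`, `K = ℚ(θ)`,
`θ² = p*`:

* §1 `eq_mul_of_mul_eq_mul_mul` — the cancellation in the domain `ℚ_p⟦T⟧` («UFD lemma»).
* §2 **`exists_eq_mul_branch_of_twistFieldEven`** / **`exists_eq_mul_minusBranch_of_twistFieldOdd`**
  (`⇒`, per datum): K-level containment + Kato INTEGRAL for `V/ℚ_∞` (`X(V/ℚ_∞)` torsion,
  `L_p(f,α,T) = ι g₀`, `g₀ ∈ char`) + `L_p(f,α,T) ≠ 0` + `X(W/ℚ_∞)` torsion ⟹ every `g ∈ char_Λ X(W/ℚ_∞)`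
  is a `Λ`-multiple of `ϖ·L_p^{[−]}(f, α, ω^{(p−1)/2}, T)` — the conclusion of
  `ChiBranchLowerDivisibility[Odd]At W p` (items 19497/19498) for that datum. Mechanism: normalise the
  generator into `Gal(ℚ̄/K)` (additive-p1), `char X(V/K·ℚ_∞) = char X(V/ℚ_∞)·char X(W/ℚ_∞)` (this
  lane), apply the K-input to `g_V·g` with `(g_V) = char X(V/ℚ_∞)` principal, cancel `ι g_V ≠ 0`.
* §3 **`forall_exists_eq_mul_mul_of_lower_of_branchLower`** (`⇐`): the containment for `V/ℚ_∞`
  (trivial branch) and the branch containment for `W` give the K-level containment — so, modulo Kato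
  and Rohrlich, the twist-field road asks for EXACTLY the conjunction «Skinner–Urban for `V/ℚ_∞`» ∧
  «the branch input of items 19497/19498»: it re-bases the missing theorem over `K`, it does not shrink it.

Consumers (sequel `…TwistFieldItems`): `ChiBranchLowerDivisibility[Odd]At W p` on the tower-surjective
rows of cell (G-ord, `e = 2`) from the K-input and the tree's Kato facts; items 19497/19498/19357 BY NAME
modulo the K-input, integral Kato for the twist models, Rohrlich and torsion of `X(E/ℚ_∞)`.

References: K. Kato, Astérisque 295 (2004) Thm. 17.4 [Kato2004Asterisque]; D. Rohrlich, Invent. Math.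
75 (1984) Theorem p. 409 [RohrlichInventiones1984]; R. Greenberg, LNM 1716 (1999) §1, §5
[GreenbergLNM1716]; Skinner–Urban, Invent. Math. 195 (2014) Thm. 3.6.4 [SkinnerUrban2014];
Mazur–Tate–Teitelbaum, Invent. Math. 84 (1986) §I.13–I.14 [MazurTateTeitelbaum1986Invent].
-/

set_option autoImplicit false
set_option linter.dupNamespace false

noncomputable section

open scoped Classical MatrixGroups ModularForm

open CongruenceSubgroup WeierstrassCurve Literature.NumberTheory.EllipticCurves
  Literature.NumberTheory.EllipticCurves.ModularForms
  Literature.NumberTheory.EllipticCurves.Rank1Residual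
  Literature.NumberTheory.GaloisRepresentations

namespace Summit.BirchSwinnertonDyer.BirchSwinnertonDyer.Theorems.AdditiveBranchIMCTwistField

open Summit.BirchSwinnertonDyer.Rank1Residual.Additive (TowerSelmerDualData towerSelmerDualData
  isCyclotomicVariable_mul_of_mem_kerSubgroup)
open Summit.BirchSwinnertonDyer.Rank1Residual.AdditivePotMult (exists_mul_mem_galRange
  isTopGenerator_mul_of_mem_kerSubgroup)

/-! ## §1 Cancellation in `ℚ_p⟦T⟧` -/

section Cancel

variable {p : ℕ} [Fact p.Prime]

/-- **The UFD lemma behind the twist-field road** (cancellation in the domain `ℚ_p⟦T⟧`): if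
`ι(g_V · g) = ι h · (L · B)` (the K-level containment at the product of the two eigen-generators),
`ι g₀ = L` with `g₀ = m · g_V` (Kato's integral divisibility at the generator `g_V` of
`char_Λ X(V/ℚ_∞)`) and `L ≠ 0` (Rohrlich), then `ι g = ι (h·m) · B`. [folklore] -/
theorem eq_mul_of_mul_eq_mul_mul {g gV h m g₀ : IwasawaAlgebra p} {L B : PowerSeries ℚ_[p]}
    (hK : iwasawaToPowerSeries p (gV * g) = iwasawaToPowerSeries p h * (L * B))
    (hg₀ : iwasawaToPowerSeries p g₀ = L) (hm : m * gV = g₀) (hL : L ≠ 0) :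
    iwasawaToPowerSeries p g = iwasawaToPowerSeries p (h * m) * B := by
  have hgV : iwasawaToPowerSeries p gV ≠ 0 := by
    intro h0
    apply hL
    rw [← hg₀, ← hm, map_mul, h0, mul_zero]
  refine mul_left_cancel₀ hgV ?_
  rw [← map_mul, hK, ← hg₀, ← hm, map_mul, map_mul]
  ring

/-- **The converse bookkeeping**: if `ι g_V = ι h₁ · L` and `ι g = ι h₂ · B` then
`ι(g_V · g) = ι(h₁ h₂) · (L · B)`. [folklore] -/
theorem mul_eq_of_eq_mul_of_eq_mul {gV g h₁ h₂ : IwasawaAlgebra p} {L B : PowerSeries ℚ_[p]}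
    (h1 : iwasawaToPowerSeries p gV = iwasawaToPowerSeries p h₁ * L)
    (h2 : iwasawaToPowerSeries p g = iwasawaToPowerSeries p h₂ * B) :
    iwasawaToPowerSeries p (gV * g) = iwasawaToPowerSeries p (h₁ * h₂) * (L * B) := by
  rw [map_mul, h1, h2, map_mul]; ring

end Cancel

/-! ## §2 `⇒`: the K-level containment gives the branch containment (Kato integral on `V`, `L_p(f) ≠ 0`) -/

section Forward

variable (V : WeierstrassCurve ℚ) [V.IsElliptic] [V.IsGloballyMinimal] (K : Type) [Field K]
  [NumberField K] (h2 : Module.finrank ℚ K = 2) {θ : K} (hθ : θ ∉ Set.range (algebraMap ℚ K))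
  (p : ℕ) [hp : Fact p.Prime] (κ : ZpExtension ℚ p) [(galRange (K := ℚ) K).Normal]
  {W : WeierstrassCurve ℚ} [W.IsElliptic] {C : VariableChange ℚ}
  {γ : Field.absoluteGaloisGroup ℚ} {N : ℕ} [NeZero N] {f : CuspForm (Gamma0 N) 2}

include h2 hθ in
/-- **`⇒`, EVEN branch, per datum.** Let `V/ℚ` be good ordinary at `p ≡ 1 (mod 4)`, `K = ℚ(θ)`,
`θ² = p`, `W = C • V^{(p)}` a model of the twist, `κ` cyclotomic with topological generator `γ`
matching the cyclotomic variable, `f` the newform of `V`. ASSUME: the K-level containment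
`TwistFieldLowerDivisibilityEvenAt V p`; Kato's divisibility for `V` over `ℚ_∞` in INTEGRAL form at
every generator (`X(V/ℚ_∞)` torsion and `L_p(f, α, T) = ι g₀`, `g₀ ∈ char_Λ X(V/ℚ_∞)` — Kato 2004
Thm. 17.4 (1)(3) under `ρ_{V,p}` tower-surjective, displayed); `L_p(f, α, T) ≠ 0` (Rohrlich 1984,
displayed); and `X(W/ℚ_∞)` torsion for the datum at hand. THEN every `g ∈ char_Λ X(W/ℚ_∞)` is a
`Λ`-multiple of `ϖ·L_p(f, α, ω^{(p−1)/2}, T)` — the conclusion of `ChiBranchLowerDivisibilityAt W p`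
for this datum. Proof: normalise `γ` into `Gal(ℚ̄/K)` (additive-p1), take the tower datum
`X(V/K·ℚ_∞)` there, `char X(V/K·ℚ_∞) = char X(V/ℚ_∞)·char X(W/ℚ_∞)` (this lane), apply the K-input
to `g_V · g` with `g_V` a generator of the principal ideal `char X(V/ℚ_∞)`, and cancel `ι g_V ≠ 0`.
[cite: Kato2004Asterisque, Thm. 17.4 (p. 273)] [cite: RohrlichInventiones1984, Theorem (p. 409)]
[cite: GreenbergLNM1716, §5 p. 143] -/
theorem exists_eq_mul_branch_of_twistFieldEven (hcK : θ ^ 2 = algebraMap ℚ K (p : ℚ))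
    (hCW : C • V.quadraticTwist (p : ℚ) = W) (hp1 : p % 4 = 1) (hV : GoodOrd V p)
    (hκ : κ.IsCyclotomic) (hγ : κ.IsTopGenerator γ) (hγ' : IsCyclotomicVariable p γ)
    (hf : IsNewformOf V f) (hTF : TwistFieldLowerDivisibilityEvenAt V p)
    (hKV : ∀ (γ₁ : Field.absoluteGaloisGroup ℚ) (D_V : V.SelmerDualData κ γ₁),
      κ.IsTopGenerator γ₁ → IsCyclotomicVariable p γ₁ →
        D_V.IsTorsion ∧ ∃ g₀ ∈ D_V.charIdeal,
          iwasawaToPowerSeries p g₀ = padicLFunction f (unitRoot V p : ℚ_[p]))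
    (hL : padicLFunction f (unitRoot V p : ℚ_[p]) ≠ 0)
    (D : W.SelmerDualData κ γ) (hDt : D.IsTorsion) (ϖ : ℚ)
    (hϖ : (ϖ : ℝ) * V.realPeriodRat = plusPeriod f) (g : IwasawaAlgebra p) (hg : g ∈ D.charIdeal) :
    ∃ h : IwasawaAlgebra p,
      iwasawaToPowerSeries p g =
        iwasawaToPowerSeries p h *
          (PowerSeries.C ((ϖ : ℚ) : ℚ_[p]) * padicLFunctionBranch f (unitRoot V p : ℚ_[p]) (p / 2)) := by
  have hp2 : p ≠ 2 := by rintro rfl; norm_num at hp1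
  have hpne : (p : ℚ) ≠ 0 := Nat.cast_ne_zero.mpr hp.out.ne_zero
  haveI : (V.quadraticTwist (p : ℚ)).IsElliptic := V.isElliptic_quadraticTwist hpne
  -- normalise the generator into `Gal(ℚ̄/K)`
  obtain ⟨g₀, hg₀, hγK, hWconj, -⟩ := exists_mul_mem_galRange W K h2 hθ hcK κ hp2 γ
  have hγ₁ : κ.IsTopGenerator (γ * g₀) := isTopGenerator_mul_of_mem_kerSubgroup κ hγ hg₀
  have hγ₁' : IsCyclotomicVariable p (γ * g₀) := isCyclotomicVariable_mul_of_mem_kerSubgroup κ hκ hg₀ hγ'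
  -- the three dual data at `γ * g₀`
  let D₁ : W.SelmerDualData κ (γ * g₀) :=
    Summit.BirchSwinnertonDyer.Rank1Residual.AdditivePotMult.SelmerDualData.congrGen W κ hWconj D
  let DV : V.SelmerDualData κ (γ * g₀) := V.selmerDualData κ hγ₁
  let DK : TowerSelmerDualData V κ K (γ * g₀) :=
    towerSelmerDualData V κ K (kappa_surjOn_galRange K h2 p κ hp2) hγ₁ hγK
  haveI : Module.Finite (IwasawaAlgebra p) DV.X :=
    SelmerDualData.module_finite_of_isCyclotomic V κ hκ DV hγ₁
  haveI : Module.Finite (IwasawaAlgebra p) D₁.X :=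
    SelmerDualData.module_finite_of_isCyclotomic W κ hκ D₁ hγ₁
  obtain ⟨hVt, g₁, hg₁mem, hιg₁⟩ := hKV (γ * g₀) DV hγ₁ hγ₁'
  have hD₁t : D₁.IsTorsion :=
    (Summit.BirchSwinnertonDyer.Rank1Residual.AdditivePotMult.SelmerDualData.isTorsion_congrGen_iff
      W κ hWconj D).mpr hDt
  -- the product formula of this lane
  have hprod := charIdeal_towerDual_eq_mul V K h2 hθ hcK p κ hCW hγ₁ hγK hp2 DK DV D₁ hVt hD₁t
  -- a generator of `char X(V/ℚ_∞)`
  haveI : (Literature.NumberTheory.EllipticCurves.Module.charIdeal (IwasawaAlgebra p) DV.X).IsPrincipal :=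
    charIdeal_isPrincipal_holds p DV.X
  obtain ⟨gV, hgV⟩ := Submodule.IsPrincipal.principal
    (Literature.NumberTheory.EllipticCurves.Module.charIdeal (IwasawaAlgebra p) DV.X)
  have hgVmem : gV ∈ DV.charIdeal := by
    change gV ∈ Literature.NumberTheory.EllipticCurves.Module.charIdeal (IwasawaAlgebra p) DV.X
    rw [hgV]; exact Ideal.mem_span_singleton_self gV
  have hmem : gV * g ∈ Literature.NumberTheory.EllipticCurves.Module.charIdeal (IwasawaAlgebra p) DK.X := by
    rw [hprod]; exact Ideal.mul_mem_mul hgVmem hg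
  obtain ⟨h, hh⟩ := hTF K θ hp1 h2 hθ hcK hV hκ hγ₁ hγ₁' hγK hf DK ϖ hϖ (gV * g) hmem
  have hg₁' : g₁ ∈ Submodule.span (IwasawaAlgebra p) {gV} := by
    have h' := hg₁mem
    change g₁ ∈ Literature.NumberTheory.EllipticCurves.Module.charIdeal (IwasawaAlgebra p) DV.X at h'
    rwa [hgV] at h'
  obtain ⟨m, hm⟩ := Submodule.mem_span_singleton.mp hg₁'
  exact ⟨h * m, eq_mul_of_mul_eq_mul_mul hh hιg₁ (by rw [← smul_eq_mul]; exact hm) hL⟩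

end Forward

section ForwardOdd

variable (V : WeierstrassCurve ℚ) [V.IsElliptic] [V.IsGloballyMinimal] (K : Type) [Field K]
  [NumberField K] (h2 : Module.finrank ℚ K = 2) {θ : K} (hθ : θ ∉ Set.range (algebraMap ℚ K))
  (p : ℕ) [hp : Fact p.Prime] (κ : ZpExtension ℚ p) [(galRange (K := ℚ) K).Normal]
  {W : WeierstrassCurve ℚ} [W.IsElliptic] {C : VariableChange ℚ}
  {γ : Field.absoluteGaloisGroup ℚ} {N : ℕ} [NeZero N] {f : CuspForm (Gamma0 N) 2}

include h2 hθ in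
/-- **`⇒`, ODD branch, per datum** (`p ≡ 3 (mod 4)`, `p = 3` included; `θ² = −p`, minus symbols):
the odd twin of `exists_eq_mul_branch_of_twistFieldEven` — `TwistFieldLowerDivisibilityOddAt V p`,
Kato's integral divisibility for `V/ℚ_∞`, `L_p(f, α, T) ≠ 0` and torsion of `X(W/ℚ_∞)` give, for every
`g ∈ char_Λ X(W/ℚ_∞)`, `ι g ∈ ι(Λ)·(ϖ⁻·L_p⁻(f, α, ω^{(p−1)/2}, T))` — the conclusion of
`ChiBranchLowerDivisibilityOddAt W p` for this datum. [cite: Kato2004Asterisque, Thm. 17.4 (p. 273)]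
[cite: RohrlichInventiones1984, Theorem (p. 409)] [cite: GreenbergLNM1716, §5 p. 143] -/
theorem exists_eq_mul_minusBranch_of_twistFieldOdd (hcK : θ ^ 2 = algebraMap ℚ K (-(p : ℚ)))
    (hCW : C • V.quadraticTwist (-(p : ℚ)) = W) (hp3 : p % 4 = 3) (hV : GoodOrd V p)
    (hκ : κ.IsCyclotomic) (hγ : κ.IsTopGenerator γ) (hγ' : IsCyclotomicVariable p γ)
    (hf : IsNewformOf V f) (hTF : TwistFieldLowerDivisibilityOddAt V p)
    (hKV : ∀ (γ₁ : Field.absoluteGaloisGroup ℚ) (D_V : V.SelmerDualData κ γ₁),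
      κ.IsTopGenerator γ₁ → IsCyclotomicVariable p γ₁ →
        D_V.IsTorsion ∧ ∃ g₀ ∈ D_V.charIdeal,
          iwasawaToPowerSeries p g₀ = padicLFunction f (unitRoot V p : ℚ_[p]))
    (hL : padicLFunction f (unitRoot V p : ℚ_[p]) ≠ 0)
    (D : W.SelmerDualData κ γ) (hDt : D.IsTorsion) (ϖ : ℚ)
    (hϖ : (ϖ : ℝ) * V.imaginaryPeriodRat = minusPeriod f) (g : IwasawaAlgebra p)
    (hg : g ∈ D.charIdeal) :
    ∃ h : IwasawaAlgebra p,
      iwasawaToPowerSeries p g =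
        iwasawaToPowerSeries p h *
          (PowerSeries.C ((ϖ : ℚ) : ℚ_[p]) *
            padicLFunctionMinusBranch f (unitRoot V p : ℚ_[p]) (p / 2)) := by
  have hp2 : p ≠ 2 := by rintro rfl; norm_num at hp3
  have hpne : (-(p : ℚ)) ≠ 0 := neg_ne_zero.mpr (Nat.cast_ne_zero.mpr hp.out.ne_zero)
  haveI : (V.quadraticTwist (-(p : ℚ))).IsElliptic := V.isElliptic_quadraticTwist hpne
  obtain ⟨g₀, hg₀, hγK, hWconj, -⟩ := exists_mul_mem_galRange W K h2 hθ hcK κ hp2 γ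
  have hγ₁ : κ.IsTopGenerator (γ * g₀) := isTopGenerator_mul_of_mem_kerSubgroup κ hγ hg₀
  have hγ₁' : IsCyclotomicVariable p (γ * g₀) := isCyclotomicVariable_mul_of_mem_kerSubgroup κ hκ hg₀ hγ'
  let D₁ : W.SelmerDualData κ (γ * g₀) :=
    Summit.BirchSwinnertonDyer.Rank1Residual.AdditivePotMult.SelmerDualData.congrGen W κ hWconj D
  let DV : V.SelmerDualData κ (γ * g₀) := V.selmerDualData κ hγ₁
  let DK : TowerSelmerDualData V κ K (γ * g₀) :=
    towerSelmerDualData V κ K (kappa_surjOn_galRange K h2 p κ hp2) hγ₁ hγK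
  haveI : Module.Finite (IwasawaAlgebra p) DV.X :=
    SelmerDualData.module_finite_of_isCyclotomic V κ hκ DV hγ₁
  haveI : Module.Finite (IwasawaAlgebra p) D₁.X :=
    SelmerDualData.module_finite_of_isCyclotomic W κ hκ D₁ hγ₁
  obtain ⟨hVt, g₁, hg₁mem, hιg₁⟩ := hKV (γ * g₀) DV hγ₁ hγ₁'
  have hD₁t : D₁.IsTorsion :=
    (Summit.BirchSwinnertonDyer.Rank1Residual.AdditivePotMult.SelmerDualData.isTorsion_congrGen_iff
      W κ hWconj D).mpr hDt
  have hprod := charIdeal_towerDual_eq_mul V K h2 hθ hcK p κ hCW hγ₁ hγK hp2 DK DV D₁ hVt hD₁t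
  haveI : (Literature.NumberTheory.EllipticCurves.Module.charIdeal (IwasawaAlgebra p) DV.X).IsPrincipal :=
    charIdeal_isPrincipal_holds p DV.X
  obtain ⟨gV, hgV⟩ := Submodule.IsPrincipal.principal
    (Literature.NumberTheory.EllipticCurves.Module.charIdeal (IwasawaAlgebra p) DV.X)
  have hgVmem : gV ∈ DV.charIdeal := by
    change gV ∈ Literature.NumberTheory.EllipticCurves.Module.charIdeal (IwasawaAlgebra p) DV.X
    rw [hgV]; exact Ideal.mem_span_singleton_self gV
  have hmem : gV * g ∈ Literature.NumberTheory.EllipticCurves.Module.charIdeal (IwasawaAlgebra p) DK.X := by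
    rw [hprod]; exact Ideal.mul_mem_mul hgVmem hg
  obtain ⟨h, hh⟩ := hTF K θ hp3 h2 hθ hcK hV hκ hγ₁ hγ₁' hγK hf DK ϖ hϖ (gV * g) hmem
  have hg₁' : g₁ ∈ Submodule.span (IwasawaAlgebra p) {gV} := by
    have h' := hg₁mem
    change g₁ ∈ Literature.NumberTheory.EllipticCurves.Module.charIdeal (IwasawaAlgebra p) DV.X at h'
    rwa [hgV] at h'
  obtain ⟨m, hm⟩ := Submodule.mem_span_singleton.mp hg₁'
  exact ⟨h * m, eq_mul_of_mul_eq_mul_mul hh hιg₁ (by rw [← smul_eq_mul]; exact hm) hL⟩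

end ForwardOdd

/-! ## §3 `⇐`: the branch containment for `W` and the containment for `V/ℚ_∞` give the K-level one -/

section Backward

variable (V : WeierstrassCurve ℚ) [V.IsElliptic] [V.IsGloballyMinimal] (K : Type) [Field K]
  [NumberField K] (h2 : Module.finrank ℚ K = 2) {θ : K} (hθ : θ ∉ Set.range (algebraMap ℚ K))
  (p : ℕ) [hp : Fact p.Prime] (κ : ZpExtension ℚ p) [(galRange (K := ℚ) K).Normal]
  {W : WeierstrassCurve ℚ} [W.IsElliptic] {C : VariableChange ℚ}
  {γ : Field.absoluteGaloisGroup ℚ}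

omit [V.IsGloballyMinimal] [W.IsElliptic] in
include h2 hθ in
/-- **`⇐` («no free lunch»), per datum, BOTH parities at once (abstract `L`, `B`).** If for the dual
data `D_V = X(V/ℚ_∞)` and `D = X(W/ℚ_∞)` at a generator `γ ∈ Gal(ℚ̄/K)` (both finitely generated
torsion) one has `char_Λ X(V/ℚ_∞) ⊆ (L)` (every element a `Λ`-multiple of `L` in `ℚ_p⟦T⟧` — the
Skinner–Urban containment for `V` on the trivial branch) and `char_Λ X(W/ℚ_∞) ⊆ (B)` (the branch
containment), then EVERY `g ∈ char_Λ X(V/K·ℚ_∞)` is a `Λ`-multiple of `L · B` — the K-level containment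
for the tower datum `D_K`, by `char X(V/K·ℚ_∞) = char X(V/ℚ_∞)·char X(W/ℚ_∞)` (this lane) and
induction over the product ideal. So the twist-field input is implied by (and, given Kato and
Rohrlich, equivalent to) the conjunction of the two `ℚ`-level containments.
[cite: GreenbergLNM1716, §1 p. 60, §5 p. 143] [cite: SkinnerUrban2014, Thm. 3.6.4 (shape)] -/
theorem forall_exists_eq_mul_mul_of_lower_of_branchLower {c : ℚ} (hcK : θ ^ 2 = algebraMap ℚ K c)
    [(V.quadraticTwist c).IsElliptic] (hCW : C • V.quadraticTwist c = W) (hp2 : p ≠ 2)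
    (hγ : κ.IsTopGenerator γ) (hγK : γ ∈ galRange (K := ℚ) K) (D_K : TowerSelmerDualData V κ K γ)
    (D_V : V.SelmerDualData κ γ) (D : W.SelmerDualData κ γ) [Module.Finite (IwasawaAlgebra p) D_V.X]
    [Module.Finite (IwasawaAlgebra p) D.X] (hVt : D_V.IsTorsion) (hDt : D.IsTorsion)
    {L B : PowerSeries ℚ_[p]}
    (hV : ∀ x ∈ D_V.charIdeal, ∃ h : IwasawaAlgebra p,
      iwasawaToPowerSeries p x = iwasawaToPowerSeries p h * L)
    (hW : ∀ y ∈ D.charIdeal, ∃ h : IwasawaAlgebra p,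
      iwasawaToPowerSeries p y = iwasawaToPowerSeries p h * B) :
    ∀ g ∈ Literature.NumberTheory.EllipticCurves.Module.charIdeal (IwasawaAlgebra p) D_K.X,
      ∃ h : IwasawaAlgebra p, iwasawaToPowerSeries p g = iwasawaToPowerSeries p h * (L * B) := by
  intro g hg
  rw [charIdeal_towerDual_eq_mul V K h2 hθ hcK p κ hCW hγ hγK hp2 D_K D_V D hVt hDt] at hg
  refine Submodule.mul_induction_on hg (fun x hx y hy ↦ ?_) (fun x y ⟨hx, hhx⟩ ⟨hy, hhy⟩ ↦ ?_)
  · obtain ⟨h₁, hh₁⟩ := hV x hx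
    obtain ⟨h₂, hh₂⟩ := hW y hy
    exact ⟨h₁ * h₂, mul_eq_of_eq_mul_of_eq_mul hh₁ hh₂⟩
  · exact ⟨hx + hy, by rw [map_add, hhx, hhy, map_add, add_mul]⟩

end Backward

end Summit.BirchSwinnertonDyer.BirchSwinnertonDyer.Theorems.AdditiveBranchIMCTwistField

end
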